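import Summits.BirchSwinnertonDyer.BirchSwinnertonDyer.Theorems.PrintCFramBottomClassIndexLawFiveLeFlipRungOfRung
import Summits.BirchSwinnertonDyer.BirchSwinnertonDyer.Theorems.PrintCFramBottomClassIndexLawFiveLeFlipRungOfJML
import Literature.NumberTheory.ModularForms.RamanujanTypeCongruencesHalfIntegralWeight
import Literature.NumberTheory.ModularForms.CohenEisensteinSeriesModularity
import Mathlib.FieldTheory.Finite.Basic
import HarnessLib

/-!
# Crux `PrintCFram.BottomClassIndexLawFiveLe` (stmt-BirchSwinnertonDyer-20372), line `eisenstein-resource-bdp-line` (registry v28 → v30):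
# RAUM'S RAMIFIED SQUARE-CLASS COUPLING — the flipped rung at EVERY odd prime `q ∣ m`, level-raising primes included:
# (RungAll⁶) ⟸ NF-A ∧ Raum 2023 Prop. 2.3 ∧ (HInt⁶), and (FlipRungAll⁶) ⟸ (RungAll⁶)
# (cell `bsd-print-cfram`, width seat `bsd-line-cfram-p1-w2` g15; THEOREMS ONLY, `--supports` 20372; BSD is not proved by any of this)

HONEST FRAMING. Nothing here is a statement about BSD; no registered stub is closed by this file alone. Registry v28's analytic
research residue is «a REGULAR class datum whose `m` has a prime `q ≡ −1 (mod 4p)`» — the primes at which the flipped-cusp rung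
(FlipRung⁶) (LEAD g14, crux notes lead-g14 §2) cannot be used because its Fricke weight `1 − q*`, `q* = J(−1|q)·q`, vanishes mod `p`
(`stub_flipRung` carries the hypothesis `¬ (p ∣ q·J(−1|q) − 1)`). M. Raum, *Relations among Ramanujan-type congruences II*,
Forum Math. 35 (2023) = arXiv:2105.13170, PROPOSITION 2.3 (typed statement-only as
`Literature.NumberTheory.ModularForms.Raum2023.prop23_ramanujanCongruence_ramifiedSquareClasses`, p709992) couples the two
RAMIFIED square classes `{p·u : (u|p) = ±1}` of a Ramanujan-type congruence of ANY half-integral weight form of level prime to `p`,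
for EVERY odd `ℓ` — the weight is a Kloosterman sum `K₂(ψ, a)`, a unit mod every odd `ℓ` (his Lemma 2.4), produced by the LOWER
UNIPOTENT `γ ≡ (1 0; 1 1) (mod p²)` rather than the Fricke element; there is no level-raising exception. Applied to Cohen's
`H_k ∈ M_{(2k+1)/2}(4, χ₀)` (NF-A = `Cohen1975.thm31_cohenSeries_mem_halfIntModularForms`) with the period `M = m·lcm(24, m)` of the
`τ`-cut (so `M_q = q²` and `q ∥ β` on every cut residue `β`), it yields the rung of w8 g9's layer A WITHOUT the flippability hypothesis:

* **(RungAll⁶)** := (Rung⁶) (the `hRung` binder of `FlipRung.flipRung_six_of_rung`, p707470) with the single line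
  `¬ ((p : ℤ) ∣ (q : ℤ) * jacobiSym (-1) q - 1) →` DELETED — «‖H(k, a)‖_p ≤ p⁻¹ on the τ-cut ⟹ on the cut flipped at q» for every
  class datum of the six leaf primes, every `±1` pattern `τ` and EVERY odd prime `q ∣ m`;
* **(FlipRungAll⁶)** := (FlipRung⁶) (the `hFlip` binder of `FlipRung.seedOffExc_of_flipRung_of_bad`, p706253) with the same line deleted;
* **(HInt⁶)** := «for every class datum `(p, k)` of the six leaf primes, EVERY Cohen number is `p`-integral: `∀ n, ‖H(k, n)‖_p ≤ 1`» —
  Raum's hypothesis «Fourier coefficients in `O_{K,ℓ}`» for `f = H_k`; print-derivable (von Staudt–Clausen for `ζ(1−2k)` and `B_k/k`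
  since `(p−1) ∤ 2k, k`; Carlitz / Lang's measure for `k⁻¹B_{k,χ_D}`, the tree's `CarlitzIntegrality`; at `D = −p` the exponent
  `k + (p−1)/2 ≢ 0 (mod p−1)`), kept here as an explicit binder and discharged in a separate file.

THEOREMS: §1 arithmetic of the cut period (`not_sq_dvd_lcm`, `jacobiSym_neg_natCast_congr`,
`not_dvd_of_jacobiSym_neg_ne_zero`, `cut_of_modEq` = the `τ`-cut predicate is `m·lcm(24,m)`-periodic); §2 **`rungAll_six_of_raum`**;
the companion file `…FlipRungAllOfRungAll` proves **`flipRungAll_six_of_rungAll`** (w8 g9's layer-A proof verbatim, `hstar` deleted). With LEAD g14's §3 induction run over ALL of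
`Q_off` and w7 g8's 2-adic rung (FlipRungTwo⁶), (FlipRungAll⁶) leaves NO analytic research residue (the induction file is separate).
A kernel twin of §2 from NF-A ∧ NF-Q (no new named fact) is the typing item T8 «the lower-unipotent rung» (w3 g19 blueprint, HOME/STATUS
08:47Z). beyond-print theorem: NO (citation + bookkeeping). BSD is not proved by any of this.

References: [Raum2023RamanujanTypeII] Prop. 2.3, Lemma 2.4 (arXiv:2105.13170 pp. 20–24); [Cohen1975] Thm. 3.1, §2; [Washington1997]
Thm. 4.2, Thm. 5.11; crux notes `Lines/eisenstein-resource-bdp-line-lead-g14.md` §2, `…-w2g15-notes.md`.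
-/

set_option autoImplicit false
-- summit-side namespace `Summit.BirchSwinnertonDyer.BirchSwinnertonDyer.…` (single-conjunct summit, D-0017 layout)
set_option linter.dupNamespace false

noncomputable section

open scoped Classical NumberTheorySymbols
open NumberField DirichletCharacter Literature.NumberTheory.LFunctions
  Literature.NumberTheory.ModularForms.CohenEisenstein Literature.NumberTheory.ModularForms
  Literature.NumberTheory.EllipticCurves Literature.NumberTheory.EllipticCurves.KrizLi2019
  Literature.NumberTheory.EllipticCurves.ModularForms Literature.NumberTheory.QuadraticFields

namespace Summit.BirchSwinnertonDyer.BirchSwinnertonDyer.Theorems.PrintCFram.FlipRung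

open Summit.BirchSwinnertonDyer.BirchSwinnertonDyer.Theorems.PrintCFram

/-! ## §1 Arithmetic of the cut period `M = m · lcm(24, m)` -/

/-- **`q² ∤ lcm(24, m)`** for an odd prime `q` with `q² ∤ m` (the `q`-part of the cut period is exactly `q²·…` after multiplying by `m`).
[folklore] -/
theorem not_sq_dvd_lcm {m q : ℕ} (hm : m ≠ 0) (hq : q.Prime) (hq2 : q ≠ 2) (hq2m : ¬ q ^ 2 ∣ m) : ¬ q ^ 2 ∣ Nat.lcm 24 m := by
  intro h
  have h24 : ¬ q ^ 2 ∣ 24 := by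
    intro h'
    have hq24 : q ∣ 24 := dvd_trans (dvd_pow_self q two_ne_zero) h'
    have hq3 : q = 3 := by
      have : q ∣ 2 ^ 3 * 3 := by simpa using hq24
      rcases (Nat.Prime.dvd_mul hq).mp this with h2 | h3
      · exact absurd (Nat.prime_dvd_prime_iff_eq hq Nat.prime_two |>.mp (hq.dvd_of_dvd_pow h2)) hq2
      · exact (Nat.prime_dvd_prime_iff_eq hq Nat.prime_three).mp h3
    subst hq3
    omega
  have hl0 : Nat.lcm 24 m ≠ 0 := Nat.lcm_ne_zero (by norm_num) hm
  have key : (Nat.lcm 24 m).factorization q = max ((24 : ℕ).factorization q) (m.factorization q) := by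
    rw [Nat.factorization_lcm (by norm_num) hm]; rfl
  have hle : 2 ≤ (Nat.lcm 24 m).factorization q := (hq.pow_dvd_iff_le_factorization hl0).mp h
  have h1 : (24 : ℕ).factorization q < 2 := by
    by_contra hge
    exact h24 ((hq.pow_dvd_iff_le_factorization (by norm_num)).mpr (by omega))
  have h2 : m.factorization q < 2 := by
    by_contra hge
    exact hq2m ((hq.pow_dvd_iff_le_factorization hm).mpr (by omega))
  rw [key] at hle
  rcases max_cases ((24 : ℕ).factorization q) (m.factorization q) with ⟨hmax, -⟩ | ⟨hmax, -⟩ <;> omega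

/-- `J(−t | q) = J(−t' | q)` when `t ≡ t' (mod q)`. [cite: IrelandRosen1990, Prop. 5.2.2] -/
theorem jacobiSym_neg_natCast_congr {t t' q : ℕ} (h : t % q = t' % q) :
    jacobiSym (-(t : ℤ)) q = jacobiSym (-(t' : ℤ)) q := by
  have h1 : (t : ℤ) % (q : ℤ) = (t' : ℤ) % (q : ℤ) := by
    rw [← Int.natCast_mod, ← Int.natCast_mod, h]
  have h2 : (-(t : ℤ)) % (q : ℤ) = (-(t' : ℤ)) % (q : ℤ) := Int.ModEq.neg h1
  rw [jacobiSym.mod_left (-(t : ℤ)), jacobiSym.mod_left (-(t' : ℤ)), h2]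

/-- A non-zero `J(−t | q)` at a prime `q` forces `q ∤ t`. [cite: IrelandRosen1990, Prop. 5.2.2] -/
theorem not_dvd_of_jacobiSym_neg_ne_zero {t q : ℕ} (hq : q.Prime) (h : jacobiSym (-(t : ℤ)) q ≠ 0) : ¬ q ∣ t := by
  intro hqt
  haveI : NeZero q := ⟨hq.ne_zero⟩
  apply h
  refine jacobiSym.eq_zero_iff_not_coprime.mpr fun hg => ?_
  rw [Int.gcd_eq_natAbs, Int.natAbs_neg, Int.natAbs_natCast, Int.natAbs_natCast, Nat.gcd_eq_right hqt] at hg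
  exact hq.one_lt.ne' hg

/-- **The `τ`-cut predicate is periodic modulo `m·T` whenever `8 ∣ T`, `3 ∣ T`, `m ∣ T`.** If `β = m·t` lies on the `τ`-cut
(`t ≡ 3 (4)`, `J(−t | q') = τ(q')` at the odd primes `q' ∣ m`, `t ≡ 7 (8)` if `2 ∣ m`, `3 ∤ t`) and `n ≡ β (mod m·T)`, then so does `n`.
[cite: Cohen1975, Thm. 3.1] -/
theorem cut_of_modEq {m T : ℕ} (hm : 0 < m) (h8 : 8 ∣ T) (h3 : 3 ∣ T) (hmT : m ∣ T) {τ : ℕ → ℤ} {t n : ℕ}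
    (hn : n ≡ m * t [MOD m * T]) (h4 : t % 4 = 3)
    (hJ : ∀ q' : ℕ, q'.Prime → q' ∣ m → q' ≠ 2 → jacobiSym (-(t : ℤ)) q' = τ q')
    (h8' : 2 ∣ m → t % 8 = 7) (h3' : ¬ 3 ∣ t) :
    m ∣ n ∧ n / m % 4 = 3 ∧
      (∀ q' : ℕ, q'.Prime → q' ∣ m → q' ≠ 2 → jacobiSym (-((n / m : ℕ) : ℤ)) q' = τ q') ∧
      (2 ∣ m → n / m % 8 = 7) ∧ ¬ 3 ∣ n / m := by
  have hmn : m ∣ n := (hn.dvd_iff (dvd_mul_right m T)).mpr (dvd_mul_right m t)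
  set s := n / m with hs
  have hns : n = m * s := (Nat.mul_div_cancel' hmn).symm
  rw [hns] at hn
  have hst : s ≡ t [MOD T] := Nat.ModEq.mul_left_cancel' hm.ne' hn
  have hst4 : s % 4 = t % 4 := hst.of_dvd (dvd_trans (by norm_num : (4 : ℕ) ∣ 8) h8)
  have hst8 : s % 8 = t % 8 := hst.of_dvd h8
  have hst3 : 3 ∣ s ↔ 3 ∣ t := (hst.of_dvd h3).dvd_iff dvd_rfl
  refine ⟨hmn, by rw [hst4, h4], fun q' hq' hq'm hq'2 => ?_, fun h2m => by rw [hst8, h8' h2m], fun h => h3' (hst3.mp h)⟩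
  have hstq : s % q' = t % q' := hst.of_dvd (dvd_trans hq'm hmT)
  rw [jacobiSym_neg_natCast_congr hstq, hJ q' hq' hq'm hq'2]

/-! ## §2 (RungAll⁶) ⟸ NF-A ∧ Raum 2023 Prop. 2.3 ∧ (HInt⁶) -/

/-- **THE RUNG AT EVERY ODD PRIME `q ∣ m`, LEVEL-RAISING PRIMES INCLUDED, from Cohen's Theorem 3.1 (NF-A), Raum's Proposition 2.3
and the `p`-integrality of all Cohen numbers (HInt⁶).** Conclusion (RungAll⁶) = w8 g9's (Rung⁶) without the hypothesis
`¬ (p ∣ q·J(−1|q) − 1)`: for every class datum `(p, m, χ, k)` of the six leaf primes, every `±1`-pattern `τ` on the odd primes of `m`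
and EVERY odd prime `q ∣ m`: if `‖H(k, a)‖_p ≤ p⁻¹` at every index `a` with `m ∣ a`, `a/m ≡ 3 (4)`, `J(−a/m | q') = τ(q')` at the odd
`q' ∣ m`, `a/m ≡ 7 (8)` if `2 ∣ m`, `3 ∤ a/m`, then the same holds with `τ` flipped at `q`. PROOF. `H_k ∈ M_{(2k+1)/2}(4, χ₀)` with
`qCoeffs = H(k,·)` (NF-A), all `p`-integral (HInt⁶). Let `T = lcm(24, m)`, `M = m·T`: the `τ`-cut predicate is `M`-periodic (§1
`cut_of_modEq`), `M_q = q²` (`q ∥ m` by w8 g9's `not_sq_dvd_conductor_of_odd_prime`, `q ∥ T` by `not_sq_dvd_lcm`), and every cut index is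
exactly divisible by `q` (its Jacobi symbol at `q` is `±1`). Given an index `a = m·t_a` of the FLIPPED cut, choose (Chinese remainder) `t`
with `t ≡ t_a (mod T/q)` and `t ≡ t_a·c (mod q)` for a non-residue `c` mod `q`: then `β = m·t` lies on the UNFLIPPED cut, `q ∥ β`, and
`β ≡ a (mod M/q²)`; the hypothesis gives the Ramanujan-type congruence of `H_k` mod `p` on `Mℤ + β`, and Raum's Proposition 2.3
(`ℓ = p ≠ 2`, his `p` = our `q ∤ 4p`) transports it to `Mℤ + a ∋ a`. [cite: Raum2023RamanujanTypeII, Prop. 2.3 (arXiv:2105.13170 p. 20)]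
[cite: Cohen1975, Thm. 3.1] -/
theorem rungAll_six_of_raum (hA : Cohen1975.thm31_cohenSeries_mem_halfIntModularForms)
    (hR : Raum2023.prop23_ramanujanCongruence_ramifiedSquareClasses)
    (hInt : ∀ (p : ℕ) [Fact p.Prime] (k : ℕ), (p = 7 ∨ p = 11 ∨ p = 19 ∨ p = 43 ∨ p = 67 ∨ p = 163) →
      (k = (p + 1) / 4 ∨ k = (3 * p - 1) / 4) → ∀ n : ℕ, ‖((cohenH k n : ℚ) : ℚ_[p])‖ ≤ 1) :
    ∀ (p : ℕ) [Fact p.Prime] (m : ℕ) [NeZero m] (χ : DirichletCharacter ℚ_[p] m) (k : ℕ),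
      (p = 7 ∨ p = 11 ∨ p = 19 ∨ p = 43 ∨ p = 67 ∨ p = 163) →
      m.Coprime p → χ.IsPrimitive → χ.IsQuadratic → (k = (p + 1) / 4 ∨ k = (3 * p - 1) / 4) →
      2 ≤ k → k ≤ p - 2 → χ (-1) * (-1) ^ k = -1 →
      ∀ (τ : ℕ → ℤ) (q : ℕ), q.Prime → q ∣ m → q ≠ 2 →
      (∀ q' : ℕ, q'.Prime → q' ∣ m → q' ≠ 2 → (τ q' = 1 ∨ τ q' = -1)) →
      (∀ a : ℕ, m ∣ a → a / m % 4 = 3 →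
        (∀ q' : ℕ, q'.Prime → q' ∣ m → q' ≠ 2 → jacobiSym (-((a / m : ℕ) : ℤ)) q' = τ q') →
        (2 ∣ m → a / m % 8 = 7) → ¬ 3 ∣ a / m → ‖((cohenH k a : ℚ) : ℚ_[p])‖ ≤ (p : ℝ)⁻¹) →
      ∀ a : ℕ, m ∣ a → a / m % 4 = 3 →
        (∀ q' : ℕ, q'.Prime → q' ∣ m → q' ≠ 2 → jacobiSym (-((a / m : ℕ) : ℤ)) q' = (if q' = q then -τ q' else τ q')) →
        (2 ∣ m → a / m % 8 = 7) → ¬ 3 ∣ a / m → ‖((cohenH k a : ℚ) : ℚ_[p])‖ ≤ (p : ℝ)⁻¹ := by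
  intro p _ m _ χ k hp6 hmp hχ hχq hk hk2 _hkp _hpar τ q hq hqm hq2 hτ hHyp a hma ha4 hJa h8a h3a
  have hpp : p.Prime := Fact.out
  have hp2 : p ≠ 2 := by rcases hp6 with h | h | h | h | h | h <;> omega
  have hm0 : 0 < m := Nat.pos_of_ne_zero (NeZero.ne m)
  haveI : Fact q.Prime := ⟨hq⟩
  -- `q ≠ p`, `q ∥ m`
  have hqp : q ≠ p := by
    rintro rfl
    have : Nat.Coprime q q := Nat.Coprime.coprime_dvd_left hqm hmp
    rw [Nat.coprime_self] at this
    exact hq.ne_one this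
  have hq2m : ¬ q ^ 2 ∣ m := not_sq_dvd_conductor_of_odd_prime hχ hχq hq hq2 hqm
  -- the period `T = lcm(24, m)`, `M = m·T`
  set T : ℕ := Nat.lcm 24 m with hTdef
  have hT8 : 8 ∣ T := dvd_trans (by norm_num : (8 : ℕ) ∣ 24) (Nat.dvd_lcm_left 24 m)
  have hT3 : 3 ∣ T := dvd_trans (by norm_num : (3 : ℕ) ∣ 24) (Nat.dvd_lcm_left 24 m)
  have hmT : m ∣ T := Nat.dvd_lcm_right 24 m
  have hqT : q ∣ T := dvd_trans hqm hmT
  have hq2T : ¬ q ^ 2 ∣ T := not_sq_dvd_lcm hm0.ne' hq hq2 hq2m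
  obtain ⟨m', hm'⟩ := hqm
  obtain ⟨T', hT'⟩ := hqT
  have hq0 : 0 < q := hq.pos
  have hqm' : ¬ q ∣ m' := fun h => hq2m (by rw [hm', pow_two]; exact Nat.mul_dvd_mul_left q h)
  have hqT' : ¬ q ∣ T' := fun h => hq2T (by rw [hT', pow_two]; exact Nat.mul_dvd_mul_left q h)
  have hcopT'q : T'.Coprime q := (Nat.coprime_comm.mp ((Nat.Prime.coprime_iff_not_dvd hq).mpr hqT'))
  -- divisibilities of `T'` (the part of `T` prime to `q`)
  have h2q : Nat.Coprime 2 q := (Nat.coprime_primes Nat.prime_two hq).mpr (Ne.symm hq2)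
  have h8T' : 8 ∣ T' := by
    have h8q : Nat.Coprime 8 q := by simpa using Nat.Coprime.pow_left 3 h2q
    exact h8q.dvd_of_dvd_mul_left (hT' ▸ hT8)
  have h4T' : 4 ∣ T' := dvd_trans (by norm_num : (4 : ℕ) ∣ 8) h8T'
  -- the flipped index `a = m·t_a`, `q ∤ t_a`
  set ta : ℕ := a / m with hta
  have ha : a = m * ta := (Nat.mul_div_cancel' hma).symm
  have hJq : jacobiSym (-(ta : ℤ)) q = -τ q := by simpa using hJa q hq ⟨m', hm'⟩ hq2
  have hτq : τ q = 1 ∨ τ q = -1 := hτ q hq ⟨m', hm'⟩ hq2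
  have hqta : ¬ q ∣ ta := not_dvd_of_jacobiSym_neg_ne_zero hq (by
    rw [hJq]; rcases hτq with h | h <;> rw [h] <;> norm_num)
  -- a quadratic non-residue `c` mod `q`
  obtain ⟨x, hx⟩ := FiniteField.exists_nonsquare (F := ZMod q) (by rw [ZMod.ringChar_zmod_n]; exact hq2)
  set c : ℕ := x.val with hc
  have hJc : jacobiSym (c : ℤ) q = -1 := by
    rw [← jacobiSym.legendreSym.to_jacobiSym, legendreSym.eq_neg_one_iff]
    simpa [hc] using hx
  -- Chinese remainder: `t ≡ t_a (mod T')`, `t ≡ t_a·c (mod q)`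
  obtain ⟨t, ht1, ht2⟩ := Nat.chineseRemainder hcopT'q ta (ta * c)
  have ht4 : t % 4 = 3 := by rw [ht1.of_dvd h4T']; exact ha4
  have ht8 : 2 ∣ m → t % 8 = 7 := fun h2m => by rw [ht1.of_dvd h8T']; exact h8a h2m
  have hJt : ∀ q' : ℕ, q'.Prime → q' ∣ m → q' ≠ 2 → jacobiSym (-(t : ℤ)) q' = τ q' := by
    intro q' hq' hq'm hq'2
    by_cases hqq : q' = q
    · subst hqq
      rw [jacobiSym_neg_natCast_congr ht2, show (-((ta * c : ℕ) : ℤ)) = (-(ta : ℤ)) * (c : ℤ) by push_cast; ring,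
        jacobiSym.mul_left, hJq, hJc]
      ring
    · have hq'T' : q' ∣ T' := by
        have hq'T : q' ∣ q * T' := by rw [← hT']; exact dvd_trans hq'm hmT
        rcases (Nat.Prime.dvd_mul hq').mp hq'T with h | h
        · exact absurd ((Nat.prime_dvd_prime_iff_eq hq' hq).mp h) hqq
        · exact h
      rw [jacobiSym_neg_natCast_congr (ht1.of_dvd hq'T')]
      simpa [hqq] using hJa q' hq' hq'm hq'2
  have hqt : ¬ q ∣ t := not_dvd_of_jacobiSym_neg_ne_zero hq (by
    rw [hJt q hq ⟨m', hm'⟩ hq2]; rcases hτq with h | h <;> rw [h] <;> norm_num)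
  have ht3 : ¬ 3 ∣ t := by
    by_cases hq3 : q = 3
    · subst hq3; exact hqt
    · have h3T' : 3 ∣ T' := by
        have h3q : Nat.Coprime 3 q := (Nat.coprime_primes Nat.prime_three hq).mpr (Ne.symm hq3)
        exact h3q.dvd_of_dvd_mul_left (hT' ▸ hT3)
      intro h
      exact h3a (((ht1.of_dvd h3T').dvd_iff dvd_rfl).mp h)
  -- Cohen's `H_k` as a member of `M_{(2k+1)/2}(4, χ₀)` with `p`-integral rational coefficients
  obtain ⟨H, hHmem, hHcoef⟩ := hA k hk2
  have hint := hInt p k hp6 hk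
  -- Raum's hypotheses on `(M, β, q)` with `M = m·T = q²·(m'·T')`, `β = m·t = q·(m'·t)`
  have hMeq : m * T = q ^ 2 * (m' * T') := by rw [hm', hT']; ring
  have hβeq : m * t = q * (m' * t) := by rw [hm']; ring
  have haeq : a = q * (m' * ta) := by rw [ha, hm']; ring
  have hqℓN : ¬ q ∣ p * 4 := by
    intro h
    rcases (Nat.Prime.dvd_mul hq).mp h with h | h
    · exact hqp ((Nat.prime_dvd_prime_iff_eq hq hpp).mp h)
    · exact hq2 ((Nat.prime_dvd_prime_iff_eq hq Nat.prime_two).mp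
        (hq.dvd_of_dvd_pow (show q ∣ 2 ^ 2 by rw [show (2 : ℕ) ^ 2 = 4 by norm_num]; exact h)))
  have hsqM : q ^ 2 ∣ m * T := ⟨m' * T', hMeq⟩
  have hcubeM : ¬ q ^ 3 ∣ m * T := by
    rw [hMeq, pow_succ]
    intro h
    rcases (Nat.Prime.dvd_mul hq).mp ((Nat.mul_dvd_mul_iff_left (pow_pos hq0 2)).mp h) with h | h
    · exact hqm' h
    · exact hqT' h
  have hqβ : q ∣ m * t := ⟨m' * t, hβeq⟩
  have hq2β : ¬ q ^ 2 ∣ m * t := by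
    rw [hβeq, pow_two]
    intro h
    rcases (Nat.Prime.dvd_mul hq).mp ((Nat.mul_dvd_mul_iff_left hq0).mp h) with h | h
    · exact hqm' h
    · exact hqt h
  have hqa : q ∣ a := ⟨m' * ta, haeq⟩
  have hq2a : ¬ q ^ 2 ∣ a := by
    rw [haeq, pow_two]
    intro h
    rcases (Nat.Prime.dvd_mul hq).mp ((Nat.mul_dvd_mul_iff_left hq0).mp h) with h | h
    · exact hqm' h
    · exact hqta h
  have hdiv : m * T / q ^ 2 = m' * T' := by rw [hMeq, Nat.mul_div_cancel_left _ (pow_pos hq0 2)]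
  have hmod : a % (m * T / q ^ 2) = (m * t) % (m * T / q ^ 2) := by
    rw [hdiv, haeq, hβeq]
    have h1 : q * (m' * ta) ≡ q * (m' * t) [MOD q * (m' * T')] :=
      Nat.ModEq.mul_left' q (Nat.ModEq.mul_left' m' ht1.symm)
    exact h1.of_dvd ⟨q, by ring⟩
  -- the class hypothesis on `Mℤ + β`: periodicity of the `τ`-cut
  have hclass : ∀ n : ℕ, n % (m * T) = (m * t) % (m * T) → ‖((cohenH k n : ℚ) : ℚ_[p])‖ ≤ (p : ℝ)⁻¹ := by
    intro n hn
    obtain ⟨h1, h2, h3, h4, h5⟩ := cut_of_modEq hm0 hT8 hT3 hmT (τ := τ) (t := t) hn ht4 hJt ht8 ht3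
    exact hHyp n h1 h2 h3 h4 h5
  -- Raum 2023, Prop. 2.3
  exact hR p hp2 (2 * k + 1) 4 1 H ⟨k, rfl⟩ (dvd_refl 4) hHmem (fun n => cohenH k n) hHcoef hint
    (m * T) (m * t) q hq hqℓN hsqM hcubeM hqβ hq2β hclass a hqa hq2a hmod a rfl

end Summit.BirchSwinnertonDyer.BirchSwinnertonDyer.Theorems.PrintCFram.FlipRung

end
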